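import Mathlib
import Summits.ResolutionOfSingularities.ResolutionOfSingularities.Theorems.WeightedInvariantLocalWeightedDropRestrictedChartTransportPrep

/-!
# `LocalWeightedDrop`: the restricted point-blow-up chart is FUNCTORIAL under formal coordinate changes

Route `ResolutionOfSingularities/WeightedInvariant`, engine crux `LocalWeightedDrop` (stmt-ResolutionOfSingularities-8899), chain w43
[OURS · L1 W4.3 · TOT2-LINE (res-L1-w43-lead-1 g4) piece S-E1, decorated half (res-type-056); tool (T1)].  Folklore («the blow-up of a point
does not depend on the coordinates»), written out for the count game's successor convention; nothing here is a statement of any manuscript.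
No definitions.

THE STATEMENT (`exists_transport`).  Let `θ` be a formal coordinate change of `k⟦x₀, …, xₙ⟧` (zero constant terms, invertible linear part
`L_{a j} = [x_j] θ_a`), `c` an exceptional point of the point blow-up with live slot `i` (`c_i ≠ 0`), and `c̃ = L c` (`≠ 0`).  Then for some
slot `ĩ` with `c̃_ĩ ≠ 0` there is a formal coordinate change `χ` of the blown-up germ's ring `k⟦s, y⟧`, fixing the exceptional divisor up to a
unit (`χ_0 = s · w`, `w(0) = 1`), with
  `ρ_{c,i}^* (θ^* f) = χ^* (ρ_{c̃,ĩ}^* f)`   for every `f`,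
where `ρ_{c,i} : x_i ↦ c_i s, x_l ↦ s (c_l + y_l)` (`l ≠ i`, `y_l` renumbered by `Fin.predAbove i`) is the RESTRICTED CHART of
`SliceChart.subst_restrictedChart` (whose image, divided by a power of `s`, is the count game's new position `s · G|_{y_i = 0}`).
Construction: `θ_a(ρ_{c,i}) = s (c̃_a + Ψ_a)` (`…TransportPrep.exists_factor_restrictedChart`), `w = 1 + Ψ_ĩ / c̃_ĩ`, `χ_0 = s w`,
`χ_{y_a} = (c̃_a + Ψ_a) w⁻¹ − c̃_a`; the linear part of `χ` is block-triangular with the invertible block of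
`…TransportPrep.det_transportMatrix_ne_zero`.
USE (piece S-E1 and every regime theorem that reads a measure in coordinates other than the move's): the successor of `θ^* f` at `(c, i)` and the
successor of `f` at `(L c, ĩ)` differ by a formal coordinate change and a unit, so every coordinate-invariant quantity (order, tangent cone up to
`GL`, winnability, prepared `δ`-data read through a presentation) is transported.
-/

set_option linter.dupNamespace false -- mandated namespace of this single-conjunct summit

namespace Summit.ResolutionOfSingularities.ResolutionOfSingularities.Theorems

open Literature.AlgebraicGeometry.Resolution

namespace RestrictedChartTransport

open MvPowerSeries

variable {k : Type} [Field k] {n : ℕ}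

/-- The letter of `y_{p⁺m}` after slicing at `p` is `m.succ`. -/
theorem predAbove_succAbove_succ (p : Fin (n + 1)) (m : Fin n) : Fin.predAbove p (p.succAbove m).succ = m.succ := by
  rw [← Fin.succ_succAbove_succ, CobordantChartPlaneSlice.predAbove_succ_succAbove]

/-- The restricted chart family has zero constant terms. -/
theorem constantCoeff_restrictedChart (c : Fin (n + 1) → k) (i l : Fin (n + 1)) :
    constantCoeff (X 0 * (C (c l) +
      if l = i then (0 : MvPowerSeries (Fin (n + 1)) k) else X (Fin.predAbove i l.succ))) = 0 := by
  rw [map_mul, constantCoeff_X, zero_mul]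

/-! ### The transporting family `χ = (s · w, (c̃_a + Ψ_a) w⁻¹ − c̃_a)_{a ≠ ĩ}`: the chart identity -/

/-- THE CHART IDENTITY, component by component: with `w = 1 + Ψ_ĩ / c̃_ĩ`, `χ_0 = s w` and `χ_{y_a} = (c̃_a + Ψ_a) w⁻¹ − c̃_a` (`a = ĩ⁺l'`),
`χ^* (ρ_{c̃,ĩ})_a = s (c̃_a + Ψ_a)` for every `a`. -/
theorem subst_chi_restrictedChart (ct : Fin (n + 1) → k) (Ψ : Fin (n + 1) → MvPowerSeries (Fin (n + 1)) k) (ĩ : Fin (n + 1))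
    (hĩ : ct ĩ ≠ 0) (w : MvPowerSeries (Fin (n + 1)) k) (hw : w = 1 + C (ct ĩ)⁻¹ * Ψ ĩ) (hwinv : w * w⁻¹ = 1)
    (χ : Fin (n + 1) → MvPowerSeries (Fin (n + 1)) k) (hχsub : HasSubst χ) (hχ0 : χ 0 = X 0 * w)
    (hχs : ∀ l' : Fin n, χ l'.succ = (C (ct (ĩ.succAbove l')) + Ψ (ĩ.succAbove l')) * w⁻¹ - C (ct (ĩ.succAbove l')))
    (a : Fin (n + 1)) :
    subst χ (X 0 * (C (ct a) + if a = ĩ then (0 : MvPowerSeries (Fin (n + 1)) k) else X (Fin.predAbove ĩ a.succ))) =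
      X 0 * (C (ct a) + Ψ a) := by
  by_cases ha : a = ĩ
  · rw [ha, if_pos rfl, add_zero, subst_mul hχsub, subst_X hχsub, subst_C, hχ0, hw]
    have hu : C (ct ĩ)⁻¹ * C (ct ĩ) = (1 : MvPowerSeries (Fin (n + 1)) k) := by
      rw [← map_mul, inv_mul_cancel₀ hĩ, map_one]
    linear_combination (X 0 * Ψ ĩ : MvPowerSeries (Fin (n + 1)) k) * hu
  · obtain ⟨l', hl'⟩ := Fin.exists_succAbove_eq ha
    have hidx : Fin.predAbove ĩ a.succ = l'.succ := by rw [← hl', predAbove_succAbove_succ]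
    rw [if_neg ha, hidx, subst_mul hχsub, subst_X hχsub, subst_add hχsub, subst_C, subst_X hχsub, hχ0, hχs, hl']
    linear_combination (X 0 * (C (ct a) + Ψ a) : MvPowerSeries (Fin (n + 1)) k) * hwinv

/-! ### The linear part of `χ` -/

/-- Row `0` of the linear part of `χ`: `[X_{l'}] (s · w) = δ_{l' 0}` when `w(0) = 1`. -/
theorem coeff_single_X_zero_mul_unit (w : MvPowerSeries (Fin (n + 1)) k) (hw0 : constantCoeff w = 1) (l' : Fin (n + 1)) :
    coeff (Finsupp.single l' 1) (X 0 * w) = if l' = 0 then 1 else 0 := by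
  classical
  rw [coeff_single_mul_of_constantCoeff (X 0) w (constantCoeff_X 0) hw0, coeff_index_single_X]

/-- The `y`-rows of the linear part of `χ`: `[X_{l'}] ((c̃_a + Ψ_a) w⁻¹ − c̃_a) = [X_{l'}] Ψ_a − (c̃_a / c̃_ĩ) [X_{l'}] Ψ_ĩ`. -/
theorem coeff_single_Y (ct : Fin (n + 1) → k) (Ψ : Fin (n + 1) → MvPowerSeries (Fin (n + 1)) k) (ĩ : Fin (n + 1))
    (hΨ0 : ∀ a, constantCoeff (Ψ a) = 0) (w : MvPowerSeries (Fin (n + 1)) k) (hw : w = 1 + C (ct ĩ)⁻¹ * Ψ ĩ)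
    (hw0 : constantCoeff w = 1) (hwinv : w * w⁻¹ = 1) (a l' : Fin (n + 1)) :
    coeff (Finsupp.single l' 1) ((C (ct a) + Ψ a) * w⁻¹ - C (ct a)) =
      coeff (Finsupp.single l' 1) (Ψ a) - ct a * (ct ĩ)⁻¹ * coeff (Finsupp.single l' 1) (Ψ ĩ) := by
  have hYZ : (C (ct a) + Ψ a) * w⁻¹ - C (ct a) = (Ψ a - C (ct a * (ct ĩ)⁻¹) * Ψ ĩ) * w⁻¹ := by
    rw [map_mul]
    rw [hw] at hwinv ⊢
    linear_combination (C (ct a) : MvPowerSeries (Fin (n + 1)) k) * hwinv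
  have hZ0 : constantCoeff (Ψ a - C (ct a * (ct ĩ)⁻¹) * Ψ ĩ) = 0 := by simp [hΨ0]
  have hwi0 : constantCoeff w⁻¹ = 1 := by rw [MvPowerSeries.constantCoeff_inv, hw0, inv_one]
  rw [hYZ, coeff_single_mul_of_constantCoeff _ _ hZ0 hwi0, map_sub, coeff_single_C_mul]

/-- A determinant whose first row is `e_0` is the determinant of the complementary block. -/
theorem det_eq_det_submatrix_of_row_zero (M : Matrix (Fin (n + 1)) (Fin (n + 1)) k)
    (h0 : ∀ l', M 0 l' = if l' = 0 then 1 else 0) : M.det = (M.submatrix Fin.succ Fin.succ).det := by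
  rw [Matrix.det_succ_row_zero, Fin.sum_univ_succ, Finset.sum_eq_zero (fun j _ => by
    rw [h0, if_neg (Fin.succ_ne_zero j)]; ring)]
  rw [add_zero, h0, if_pos rfl, Fin.val_zero, pow_zero, one_mul, one_mul, Fin.succAbove_zero]

/-! ### The transport theorem -/

/-- **FUNCTORIALITY OF THE RESTRICTED POINT-BLOW-UP CHART UNDER FORMAL COORDINATE CHANGES.**  See the module docstring:
`ρ_{c,i}^* ∘ θ^* = χ^* ∘ ρ_{Lc,ĩ}^*` with `χ` a formal coordinate change (zero constant terms, invertible linear part) and `χ_0 = s · w`,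
`w(0) = 1`. -/
theorem exists_transport (θ : Fin (n + 1) → MvPowerSeries (Fin (n + 1)) k)
    (hθ0 : ∀ a, constantCoeff (θ a) = 0)
    (hθdet : IsUnit (Matrix.det (Matrix.of fun a j : Fin (n + 1) => coeff (Finsupp.single j 1) (θ a))))
    (c : Fin (n + 1) → k) (i : Fin (n + 1)) (hci : c i ≠ 0) :
    ∃ (ĩ : Fin (n + 1)) (χ : Fin (n + 1) → MvPowerSeries (Fin (n + 1)) k) (w : MvPowerSeries (Fin (n + 1)) k),
      (∑ j, coeff (Finsupp.single j 1) (θ ĩ) * c j) ≠ 0 ∧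
      (∀ l, constantCoeff (χ l) = 0) ∧
      IsUnit (Matrix.det (Matrix.of fun l l' : Fin (n + 1) => coeff (Finsupp.single l' 1) (χ l))) ∧
      constantCoeff w = 1 ∧ χ 0 = X 0 * w ∧
      ∀ f : MvPowerSeries (Fin (n + 1)) k,
        subst (fun l : Fin (n + 1) => X 0 * (C (c l) +
            if l = i then (0 : MvPowerSeries (Fin (n + 1)) k) else X (Fin.predAbove i l.succ))) (subst θ f) =
          subst χ (subst (fun a : Fin (n + 1) => X 0 * (C (∑ j, coeff (Finsupp.single j 1) (θ a) * c j) +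
            if a = ĩ then (0 : MvPowerSeries (Fin (n + 1)) k) else X (Fin.predAbove ĩ a.succ))) f) := by
  classical
  -- the linear part `L` and the image point `c̃ = L c`
  set L : Matrix (Fin (n + 1)) (Fin (n + 1)) k := Matrix.of fun a j : Fin (n + 1) => coeff (Finsupp.single j 1) (θ a)
    with hL
  set ct : Fin (n + 1) → k := fun a => ∑ j, coeff (Finsupp.single j 1) (θ a) * c j with hct
  have hctL : ct = L.mulVec c := by
    funext a
    simp only [hct, hL, Matrix.mulVec, dotProduct, Matrix.of_apply]
  have hLdet : L.det ≠ 0 := hθdet.ne_zero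
  have hct0 : ct ≠ 0 := by
    intro h
    apply hci
    have hc : c = 0 := Matrix.eq_zero_of_mulVec_eq_zero hLdet (by rw [← hctL, h])
    exact congrFun hc i
  obtain ⟨ĩ, hĩ⟩ : ∃ a, ct a ≠ 0 := by
    by_contra h
    push Not at h
    exact hct0 (funext h)
  have hĩ' : (L.mulVec c) ĩ ≠ 0 := by rwa [← hctL]
  have hisum : (∑ j, coeff (Finsupp.single j 1) (θ ĩ) * c j) ≠ 0 := by
    have h := hĩ
    rw [hct] at h
    exact h
  -- the factorisations `θ_a(ρ_{c,i}) = s · (C c̃_a + Ψ_a)`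
  choose Ψ hΨfac hΨ0 hΨ1 using fun a => exists_factor_restrictedChart c i (θ a) (hθ0 a)
  -- the unit `w` and the family `χ`
  obtain ⟨w, hw⟩ : ∃ w : MvPowerSeries (Fin (n + 1)) k, w = 1 + C (ct ĩ)⁻¹ * Ψ ĩ := ⟨_, rfl⟩
  have hw0 : constantCoeff w = 1 := by
    rw [hw, map_add, map_one, map_mul, hΨ0, mul_zero, add_zero]
  have hwinv : w * w⁻¹ = 1 := MvPowerSeries.mul_inv_cancel w (by rw [hw0]; exact one_ne_zero)
  obtain ⟨χ, hχ0, hχs⟩ : ∃ χ : Fin (n + 1) → MvPowerSeries (Fin (n + 1)) k, χ 0 = X 0 * w ∧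
      ∀ l' : Fin n, χ l'.succ = (C (ct (ĩ.succAbove l')) + Ψ (ĩ.succAbove l')) * w⁻¹ - C (ct (ĩ.succAbove l')) := by
    refine ⟨fun l => if hl : l = 0 then X 0 * w else
      (C (ct (ĩ.succAbove (l.pred hl))) + Ψ (ĩ.succAbove (l.pred hl))) * w⁻¹ - C (ct (ĩ.succAbove (l.pred hl))),
      dif_pos rfl, fun l' => ?_⟩
    simp only [dif_neg (Fin.succ_ne_zero l'), Fin.pred_succ]
  -- zero constant terms
  have hχc : ∀ l, constantCoeff (χ l) = 0 := by
    intro l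
    refine Fin.cases ?_ (fun l' => ?_) l
    · rw [hχ0, map_mul, constantCoeff_X, zero_mul]
    · rw [hχs]
      simp [MvPowerSeries.constantCoeff_inv, hw0, hΨ0]
  have hχsub : HasSubst χ := hasSubst_of_constantCoeff_zero hχc
  -- invertible linear part
  have hdet : (Matrix.of fun l l' : Fin (n + 1) => coeff (Finsupp.single l' 1) (χ l)).det ≠ 0 := by
    rw [det_eq_det_submatrix_of_row_zero _ (fun l' => by rw [Matrix.of_apply, hχ0, coeff_single_X_zero_mul_unit w hw0])]
    have hsub : (Matrix.of fun l l' : Fin (n + 1) => coeff (Finsupp.single l' 1) (χ l)).submatrix Fin.succ Fin.succ =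
        Matrix.of fun l m : Fin n => L (ĩ.succAbove l) (i.succAbove m) -
          (L.mulVec c) (ĩ.succAbove l) * ((L.mulVec c) ĩ)⁻¹ * L ĩ (i.succAbove m) := by
      ext l m
      have h1 : ∀ a, coeff (Finsupp.single m.succ 1) (Ψ a) = L a (i.succAbove m) := by
        intro a
        rw [← predAbove_succAbove_succ i m, hΨ1 a (i.succAbove m) (Fin.succAbove_ne i m), hL, Matrix.of_apply]
      rw [Matrix.submatrix_apply, Matrix.of_apply, Matrix.of_apply, hχs,
        coeff_single_Y ct Ψ ĩ hΨ0 w hw hw0 hwinv, h1, h1, ← hctL]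
    rw [hsub]
    exact det_transportMatrix_ne_zero L hLdet c i hci ĩ hĩ'
  refine ⟨ĩ, χ, w, hisum, hχc, isUnit_iff_ne_zero.mpr hdet, hw0, hχ0, fun f => ?_⟩
  -- the chart identity
  have hθsub : HasSubst θ := hasSubst_of_constantCoeff_zero hθ0
  have hρ : HasSubst (fun l : Fin (n + 1) => X 0 * (C (c l) +
      if l = i then (0 : MvPowerSeries (Fin (n + 1)) k) else X (Fin.predAbove i l.succ))) :=
    hasSubst_of_constantCoeff_zero fun l => constantCoeff_restrictedChart c i l
  have hρ' : HasSubst (fun a : Fin (n + 1) => X 0 * (C (∑ j, coeff (Finsupp.single j 1) (θ a) * c j) +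
      if a = ĩ then (0 : MvPowerSeries (Fin (n + 1)) k) else X (Fin.predAbove ĩ a.succ))) :=
    hasSubst_of_constantCoeff_zero fun a => constantCoeff_restrictedChart (fun a => ∑ j, coeff (Finsupp.single j 1) (θ a) * c j) ĩ a
  have hfam : (fun a : Fin (n + 1) => subst (fun l : Fin (n + 1) => X 0 * (C (c l) +
      if l = i then (0 : MvPowerSeries (Fin (n + 1)) k) else X (Fin.predAbove i l.succ))) (θ a)) =
      fun a : Fin (n + 1) => subst χ (X 0 * (C (∑ j, coeff (Finsupp.single j 1) (θ a) * c j) +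
        if a = ĩ then (0 : MvPowerSeries (Fin (n + 1)) k) else X (Fin.predAbove ĩ a.succ))) := by
    funext a
    rw [hΨfac a]
    exact (subst_chi_restrictedChart ct Ψ ĩ hĩ w hw hwinv χ hχsub hχ0 hχs a).symm
  rw [subst_comp_subst_apply hθsub hρ, subst_comp_subst_apply hρ' hχsub, hfam]

end RestrictedChartTransport

end Summit.ResolutionOfSingularities.ResolutionOfSingularities.Theorems
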